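import Mathlib.Analysis.Convex.SpecificFunctions.Basic
import Literature.MathematicalPhysics.QuantumFieldTheory.BalabanImbrieJaffe1984to88.BIJ88MultiscaleDecay223
import Literature.MathematicalPhysics.QuantumFieldTheory.BalabanImbrieJaffe1984to88.BIJ88Sect5StatementsPart2
import Literature.MathematicalPhysics.QuantumFieldTheory.BalabanImbrieJaffe1984to88.BIJ88Sect5StatementsPart3

/-!
# `BalabanImbrieJaffe1984to88.BIJ88Ineq547W1Prime` — T. Bałaban, J. Imbrie, A. Jaffe, *Effective action and cluster properties of the
abelian Higgs model*, Commun. Math. Phys. **114** (1988) 257–315 [BalabanImbrieJaffe1988]: the p. 282 bounds on the tail kernels `w′₁`,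
`∂w′₁`, `∂*w′₁`, `w₁` of §5.4 (row C2.Eq5.4.7, the part *"similarly for w′₁ …"*) — the displayed MULTISCALE SMALLNESS RESUMMATION
`Σ_{j=1}^{k−1}(L^jη)^{−2}e^{−cr(e_j)} ≤ e^{−cr(e_k)}` PROVED from the running coupling (2.2) and the localization length (2.3), and the
display's first inequality as the hence-step «(2.7) + decay + scaling» over r18's kernel shapes

statement-level skeleton of published theorems with citation tags; proofs where landed; nothing here is a claim about the Yang–Mills mass gap

PDF held: `paper:balaban1988-cmp114-bij-abelian-higgs-effective-action` (journal page = PDF page + 256); p. 282 [PDF 26] read this session as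
text and as an image rendered from the held PDF (seat folder `renders/bij88-p026.png`).

WHAT IS REPRODUCED.  SKELETON row **C2.Eq5.4.7**, the part the C2 §5 fold owner r16 lists as *«w′₁/w₁ bounds remain typed»* after p36's
model instance for `w₂` (`BIJ88Ineq547Proof.ineq547_matrix`, p247855) — cell `lit-balaban`, HOME `run/shared/lean/pub/lit-balaban/`; Phase-2
seat p08 gen 4 = unit `lit-balaban-p08` (second target of the generation, companion of `BIJ88MultiscaleDecay223` = rows C2.Eq2.23/2.13/2.16);
referee ref-5; TAKING line HOME/STATUS.md 2026-08-21T05:12:20Z.  Typed shapes: r16's `BIJ88Sect5StatementsPart2.Ineq547` (the one-letter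
bound `|w(x,b)| ≤ e^{−cr(e_k)}e^{−c dist(x,b)}`, p240155) and r16's ring-level kernels `BIJ88Sect5StatementsPart3.wPrime1` / `w1` (p243601).
p. 282, verbatim: *"The kernel w′₁ = (𝒟_k − 𝒟_{k,loc})∂*Q^{e*}_k∂□ involves only the tails not included in the expansion (2.12). Using the
regularity and exponential decay of H_j, H_{j,loc}, along with (2.7) and scaling properties of these kernels, we find that
|(∂w′₁)(p,b′)| ≦ Σ_{j=1}^{k−1} (L^jη)^{−1−(d−2)−1+(d−2)} e^{−cr(e_j)} e^{−c dist(p,b′)} ≦ e^{−cr(e_k)} e^{−c dist(p,b′)}, and similarly for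
w′₁, ∂*w′₁. Also, w′₁ is finite ranged in the sense that w′₁ = w′₁□; we use w′₁(b,b′) only for b in □₀ ⊂ □. … We have put w₁ = w′₁ + H_k□
− H_{k,loc}, and it satisfies the same bounds as w′₁."*  ((2.2) p. 260: *"e_k = (L^kε)^{(4−d)/2}e"*; (2.3): *"r(e_k) = |log e_k⁻¹|^r, r > 1"*;
(2.7): *"|H_{k,loc}(b,b′) − H_k(b,b′)| ≦ e^{−cr(e_k)}e^{−c dist(b,b′)}"*; η = L^{−k}, so the scaling factor is `(L^jη)^{−2} = L^{2(k−j)}`.)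

WHAT IS PROVED HERE (0 `sorry`, standard axioms; kind «hence-step», constants explicit; r18's/r16's abstract real kernels).
§1 SCALES: `log_inv_eK`/`log_inv_eK_succ` ((2.2): `log e_j⁻¹ = log e_{j+1}⁻¹ + ((4−d)/2)log L`), `log_inv_eK_mono`; `rpow_add_ge_linear`
(Bernoulli, real exponent `r ≥ 1`, Mathlib `one_add_mul_self_le_rpow_one_add`); **`rLen_step`**/**`rLen_scale_gap`**: with
`θ_k := r(log e_k⁻¹)^{r−1}((4−d)/2)log L`, `r(e_j) ≥ r(e_k) + (k−j)θ_k` for `j ≤ k` (`0 < e_k < 1`, `d ≤ 4`, `L ≥ 1`).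
§2 RESUMMATION: `sum_half_pow_sub_le_one`, **`smallness_sum_le`** (abstract: `a_k + (k−j)θ ≤ a_j`, `Λe^{−cθ} ≤ ½` ⟹
`Σ_{1≤j<k}Λ^{k−j}e^{−ca_j} ≤ e^{−ca_k}`), `half_of_smallCoupling` (threshold `log(2Λ)/c ≤ θ`), and THE PRINTED SECOND INEQUALITY
**`sum_scales_rLen_le`**: `Σ_{j=1}^{k−1}L^{2(k−j)}e^{−cr(e_j)} ≤ e^{−cr(e_k)}` over r18's `eK`/`rLen` under `L²e^{−cθ_k} ≤ ½` («e_k small»).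
§3 THE PRINTED FIRST INEQUALITY as kernel algebra («(2.7) and scaling properties»): `comp₃_sub_comp₃` (telescoping `HCH* − H′C′H′* =
(H−H′)CH* + H′(C−C′)H* + H′C′(H*−H′*)`), **`abs_comp₃_sub_comp₃_le`** (one ε-`Close` factor, `Decay` factors of size A ⟹ `3εA²S₁S₂e^{−(δ/4)dist}`,
by `BIJ88MultiscaleDecay223.abs_sum_mul_le_comp₃`): each tail `G^{(j)} − G^{(j)}_{loc}` is `O(e^{−cr(e_j)})` with its kernels' decay/scalings.
§4 THE ROW SHAPE: **`abs_tailSum_le`** (`|E_j| ≤ BΛ^{k−j}e^{−cr(e_j)}e^{−δdist}` ⟹ `|Σ_{1≤j<k}E_j| ≤ Be^{−cr(e_k)}e^{−δdist}`), **`ineq547_tailSum`** =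
r16's `Ineq547 Site Bond (Σ_jE_j) dist c′ r(e_k)` once the prefactor is absorbed (`Be^{−cr(e_k)} ≤ e^{−c′r(e_k)}`, `c′ ≤ δ`); the local factor
`∂*Q^{e*}_k∂□`: `abs_mul_localRight_le` (column-ℓ¹ q, range ρ: price `qe^{δρ}`); MATRIX INSTANCES on r16's ring-level kernels:
**`ineq547_wPrime1`** (`wPrime1` in `Matrix ι ι ℝ`) and **`ineq547_w1`** (`w₁ = w′₁ + H_k□ − H_{k,loc}` column-wise on `□`, `w1_apply_col`, + (2.7)).
HONEST SCOPE.  Displayed hypotheses, NOT derived here: per-scale decay/closeness of `H_j`, `H_{j,loc}`, `C^{(j)}`, `C^{(j)}_{loc}` ((I.7.2.2),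
(2.5)–(2.7)); the exponents of the «L^jη superscript» convention (print's `(L^jη)^{−1−(d−2)−1+(d−2)}` read as the factor `L^{2(k−j)}`); locality
of `∂`, `∂*Q^{e*}_k∂□`; absorption of O(1) prefactors into `e^{−cr(e_k)}` («e_k small», cf. p36's `BIJ88SmallCoupling23`, HOME/GAPS.md
G-C2-p02-02).  `∂w′₁`, `∂*w′₁` = the `abs_mul_localRight_le` step with `∂`/`∂*` as local factor (not instantiated separately).  Nothing on
d = 4 or the continuum; NOT summit progress.
-/

namespace Literature.MathematicalPhysics.QuantumFieldTheory.BalabanImbrieJaffe1984to88.BIJ88Ineq547W1Prime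

open Finset BIJ88Sect2Statements BIJ88MultiscaleDecay223
open BIJ88Sect5StatementsPart2 (Ineq547)
open BIJ88Sect5StatementsPart3 (wPrime1 w1)

noncomputable section

/-! ## §1  The scales (2.2)/(2.3): `r(e_j)` grows at least linearly down the hierarchy -/

/-- (2.2) unfolded under the logarithm: `log e_j⁻¹ = −(((4−d)/2)(j·log L + log ε) + log e)`. [cite: BalabanImbrieJaffe1988, (2.2) p.260] -/
theorem log_inv_eK {L ε e : ℝ} (hL : 0 < L) (hε : 0 < ε) (he : 0 < e) (d j : ℕ) :
    Real.log (eK L ε e d j)⁻¹ = -(((4 - (d : ℝ)) / 2) * ((j : ℝ) * Real.log L + Real.log ε) + Real.log e) := by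
  have hb : 0 < L ^ j * ε := mul_pos (pow_pos hL j) hε
  unfold eK
  rw [Real.log_inv, Real.log_mul (Real.rpow_pos_of_pos hb _).ne' he.ne', Real.log_rpow hb,
    Real.log_mul (pow_pos hL j).ne' hε.ne', Real.log_pow]

/-- One scale down the coupling shrinks by `L^{−(4−d)/2}`: `log e_j⁻¹ = log e_{j+1}⁻¹ + ((4−d)/2)·log L`.
[cite: BalabanImbrieJaffe1988, (2.2) p.260] -/
theorem log_inv_eK_succ {L ε e : ℝ} (hL : 0 < L) (hε : 0 < ε) (he : 0 < e) (d j : ℕ) :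
    Real.log (eK L ε e d j)⁻¹ = Real.log (eK L ε e d (j + 1))⁻¹ + ((4 - (d : ℝ)) / 2) * Real.log L := by
  rw [log_inv_eK hL hε he, log_inv_eK hL hε he]; push_cast; ring

/-- For `d ≤ 4` and `L ≥ 1` the scale `log e_j⁻¹` decreases in `j`: `j ≤ k ⟹ log e_k⁻¹ ≤ log e_j⁻¹`.
[cite: BalabanImbrieJaffe1988, (2.2) p.260] -/
theorem log_inv_eK_mono {L ε e : ℝ} (hL : 1 ≤ L) (hε : 0 < ε) (he : 0 < e) {d : ℕ} (hd : d ≤ 4) {j k : ℕ} (hjk : j ≤ k) :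
    Real.log (eK L ε e d k)⁻¹ ≤ Real.log (eK L ε e d j)⁻¹ := by
  have hL0 : 0 < L := by linarith
  have hd' : (d : ℝ) ≤ 4 := by exact_mod_cast hd
  have hκ : 0 ≤ ((4 - (d : ℝ)) / 2) * Real.log L := mul_nonneg (by linarith) (Real.log_nonneg hL)
  induction k, hjk using Nat.le_induction with
  | base => exact le_rfl
  | succ n _ ih =>
    have hstep := log_inv_eK_succ hL0 hε he d n
    linarith

/-- Bernoulli for real exponents `r ≥ 1`: `uʳ + r·u^{r−1}·t ≤ (u + t)ʳ` for `u > 0`, `t ≥ 0` (Mathlib `one_add_mul_self_le_rpow_one_add`).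
[cite: BalabanImbrieJaffe1988, (2.3) p.260] -/
theorem rpow_add_ge_linear {u t r : ℝ} (hu : 0 < u) (ht : 0 ≤ t) (hr : 1 ≤ r) :
    u ^ r + r * u ^ (r - 1) * t ≤ (u + t) ^ r := by
  have hs : -1 ≤ t / u := by have := div_nonneg ht hu.le; linarith
  have hB := one_add_mul_self_le_rpow_one_add hs hr
  have h1 : (0 : ℝ) ≤ 1 + t / u := by have := div_nonneg ht hu.le; linarith
  have hu0 : u ≠ 0 := hu.ne'
  have hsplit : (u + t) ^ r = u ^ r * (1 + t / u) ^ r := by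
    rw [← Real.mul_rpow hu.le h1, mul_add, mul_one, mul_div_cancel₀ t hu0]
  rw [hsplit]
  have hur : 0 ≤ u ^ r := Real.rpow_nonneg hu.le r
  calc u ^ r + r * u ^ (r - 1) * t = u ^ r * (1 + r * (t / u)) := by
        rw [Real.rpow_sub_one hu0]
        ring
    _ ≤ u ^ r * (1 + t / u) ^ r := mul_le_mul_of_nonneg_left hB hur

/-- The slope of (2.3) down the scales at step k: `θ_k = r·(log e_k⁻¹)^{r−1}·((4−d)/2)·log L`.
[cite: BalabanImbrieJaffe1988, (2.3) p.260] -/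
theorem rLen_step {L ε e r : ℝ} (hL : 1 ≤ L) (hε : 0 < ε) (he : 0 < e) (hr : 1 ≤ r) {d : ℕ} (hd : d ≤ 4) {j k : ℕ}
    (hjk : j + 1 ≤ k) (hek : eK L ε e d k < 1) (hek0 : 0 < eK L ε e d k) :
    rLen r (eK L ε e d (j + 1)) + r * Real.log (eK L ε e d k)⁻¹ ^ (r - 1) * (((4 - (d : ℝ)) / 2) * Real.log L)
      ≤ rLen r (eK L ε e d j) := by
  have hL0 : 0 < L := by linarith
  have hd' : (d : ℝ) ≤ 4 := by exact_mod_cast hd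
  have ht0 : 0 ≤ ((4 - (d : ℝ)) / 2) * Real.log L := mul_nonneg (by linarith) (Real.log_nonneg hL)
  -- u_k > 0 (e_k < 1), u_{j+1} ≥ u_k, u_j = u_{j+1} + ((4−d)/2)·log L
  have huk : 0 < Real.log (eK L ε e d k)⁻¹ := Real.log_pos ((one_lt_inv₀ hek0).2 hek)
  have hmono := log_inv_eK_mono hL hε he hd hjk
  have huj1 : 0 < Real.log (eK L ε e d (j + 1))⁻¹ := huk.trans_le hmono
  have hsucc := log_inv_eK_succ hL0 hε he d j
  have huj : 0 < Real.log (eK L ε e d j)⁻¹ := by rw [hsucc]; linarith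
  have hB := rpow_add_ge_linear huj1 ht0 hr
  -- replace u_{j+1}^{r−1} by the smaller u_k^{r−1}
  have hpow : Real.log (eK L ε e d k)⁻¹ ^ (r - 1) ≤ Real.log (eK L ε e d (j + 1))⁻¹ ^ (r - 1) :=
    Real.rpow_le_rpow huk.le hmono (by linarith)
  have hmul : r * Real.log (eK L ε e d k)⁻¹ ^ (r - 1) * (((4 - (d : ℝ)) / 2) * Real.log L)
      ≤ r * Real.log (eK L ε e d (j + 1))⁻¹ ^ (r - 1) * (((4 - (d : ℝ)) / 2) * Real.log L) :=
    mul_le_mul_of_nonneg_right (mul_le_mul_of_nonneg_left hpow (by linarith)) ht0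
  unfold rLen
  rw [abs_of_pos huj1, abs_of_pos huj, hsucc]
  linarith

/-- **`r(e_j) ≥ r(e_k) + (k − j)·θ_k` for `j ≤ k`** (`0 < e_k < 1`, `r ≥ 1`, `d ≤ 4`, `L ≥ 1`): the localization length (2.3) grows at
least linearly down the hierarchy of (2.12). [cite: BalabanImbrieJaffe1988, (2.3) p.260] -/
theorem rLen_scale_gap {L ε e r : ℝ} (hL : 1 ≤ L) (hε : 0 < ε) (he : 0 < e) (hr : 1 ≤ r) {d : ℕ} (hd : d ≤ 4) {k : ℕ}
    (hek : eK L ε e d k < 1) (hek0 : 0 < eK L ε e d k) :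
    ∀ m j : ℕ, j + m = k →
      rLen r (eK L ε e d k) + (m : ℝ) * (r * Real.log (eK L ε e d k)⁻¹ ^ (r - 1) * (((4 - (d : ℝ)) / 2) * Real.log L))
        ≤ rLen r (eK L ε e d j) := by
  intro m
  induction m with
  | zero => intro j hj; simp [← hj]
  | succ m ih =>
    intro j hj
    have h1 := ih (j + 1) (by omega)
    have h2 := rLen_step hL hε he hr hd (show j + 1 ≤ k by omega) hek hek0
    push_cast
    linarith

/-! ## §2  The resummation: `Σ_{j=1}^{k−1}(L^jη)^{−2}e^{−cr(e_j)} ≤ e^{−cr(e_k)}` -/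

/-- `Σ_{1≤j<k}(½)^{k−j} ≤ 1`. [cite: BalabanImbrieJaffe1988, (5.4.7) p.282] -/
theorem sum_half_pow_sub_le_one (k : ℕ) : ∑ j ∈ Ico 1 k, (1 / 2 : ℝ) ^ (k - j) ≤ 1 := by
  induction k with
  | zero => simp
  | succ k ih =>
    rcases Nat.eq_zero_or_pos k with hk | hk
    · subst hk; simp
    · rw [Finset.sum_Ico_succ_top hk]
      have hrw : ∑ j ∈ Ico 1 k, (1 / 2 : ℝ) ^ (k + 1 - j) = (1 / 2) * ∑ j ∈ Ico 1 k, (1 / 2 : ℝ) ^ (k - j) := by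
        rw [Finset.mul_sum]
        refine Finset.sum_congr rfl fun j hj => ?_
        have hjk : j < k := (Finset.mem_Ico.1 hj).2
        rw [show k + 1 - j = (k - j) + 1 by omega, pow_succ]
        ring
      rw [hrw, show k + 1 - k = 1 by omega, pow_one]
      linarith

/-- **Abstract smallness resummation**: if `a_k + (k − j)θ ≤ a_j` for `j ≤ k`, `c ≥ 0`, and the one-step ratio `Λe^{−cθ} ≤ ½` (Λ ≥ 0),
then `Σ_{1≤j<k} Λ^{k−j}e^{−ca_j} ≤ e^{−ca_k}`. [cite: BalabanImbrieJaffe1988, (5.4.7) p.282] -/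
theorem smallness_sum_le {a : ℕ → ℝ} {Λ c θ : ℝ} (k : ℕ) (hΛ : 0 ≤ Λ) (hc : 0 ≤ c)
    (ha : ∀ j, j ≤ k → a k + ((k - j : ℕ) : ℝ) * θ ≤ a j) (hq : Λ * Real.exp (-(c * θ)) ≤ 1 / 2) :
    ∑ j ∈ Ico 1 k, Λ ^ (k - j) * Real.exp (-(c * a j)) ≤ Real.exp (-(c * a k)) := by
  have hterm : ∀ j ∈ Ico 1 k, Λ ^ (k - j) * Real.exp (-(c * a j))
      ≤ (1 / 2 : ℝ) ^ (k - j) * Real.exp (-(c * a k)) := by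
    intro j hj
    have h1 : Real.exp (-(c * a j)) ≤ Real.exp (-(c * θ)) ^ (k - j) * Real.exp (-(c * a k)) := by
      rw [← Real.exp_nat_mul, ← Real.exp_add]
      have := mul_le_mul_of_nonneg_left (ha j (Finset.mem_Ico.1 hj).2.le) hc
      exact Real.exp_le_exp.2 (by nlinarith)
    calc Λ ^ (k - j) * Real.exp (-(c * a j)) ≤ Λ ^ (k - j) * (Real.exp (-(c * θ)) ^ (k - j) * Real.exp (-(c * a k))) :=
          mul_le_mul_of_nonneg_left h1 (pow_nonneg hΛ _)
      _ = (Λ * Real.exp (-(c * θ))) ^ (k - j) * Real.exp (-(c * a k)) := by rw [mul_pow]; ring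
      _ ≤ (1 / 2 : ℝ) ^ (k - j) * Real.exp (-(c * a k)) :=
          mul_le_mul_of_nonneg_right (pow_le_pow_left₀ (mul_nonneg hΛ (Real.exp_pos _).le) hq _) (Real.exp_pos _).le
  calc ∑ j ∈ Ico 1 k, Λ ^ (k - j) * Real.exp (-(c * a j))
      ≤ ∑ j ∈ Ico 1 k, (1 / 2 : ℝ) ^ (k - j) * Real.exp (-(c * a k)) := Finset.sum_le_sum hterm
    _ = (∑ j ∈ Ico 1 k, (1 / 2 : ℝ) ^ (k - j)) * Real.exp (-(c * a k)) := by rw [Finset.sum_mul]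
    _ ≤ 1 * Real.exp (-(c * a k)) := mul_le_mul_of_nonneg_right (sum_half_pow_sub_le_one k) (Real.exp_pos _).le
    _ = Real.exp (-(c * a k)) := one_mul _

/-- The «e_k small» threshold: `log(2Λ)/c ≤ θ` makes the one-step ratio `≤ ½`. [cite: BalabanImbrieJaffe1988, (5.4.7) p.282] -/
theorem half_of_smallCoupling {Λ c θ : ℝ} (hΛ : 0 < Λ) (hc : 0 < c) (h : Real.log (2 * Λ) / c ≤ θ) :
    Λ * Real.exp (-(c * θ)) ≤ 1 / 2 := by
  have h1 : Real.log (2 * Λ) ≤ c * θ := by have := (div_le_iff₀ hc).1 h; linarith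
  have h3 := Real.exp_le_exp.2 (neg_le_neg h1)
  rw [Real.exp_neg (Real.log (2 * Λ)), Real.exp_log (by positivity)] at h3
  calc Λ * Real.exp (-(c * θ)) ≤ Λ * (2 * Λ)⁻¹ := mul_le_mul_of_nonneg_left h3 hΛ.le
    _ = 1 / 2 := by field_simp

/-- **THE PRINTED SECOND INEQUALITY of p. 282**: `Σ_{j=1}^{k−1}(L^jη)^{−1−(d−2)−1+(d−2)}e^{−cr(e_j)} ≤ e^{−cr(e_k)}`, the scaling factor read as
`(L^jη)^{−2} = L^{2(k−j)}` (η = L^{−k}), over r18's running coupling `eK` (2.2) and localization length `rLen` (2.3): for `c ≥ 0`, `r ≥ 1`,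
`d ≤ 4`, `L ≥ 1`, `0 < e_k < 1` and the «e_k small» condition `L²e^{−cθ_k} ≤ ½`, `θ_k = r(log e_k⁻¹)^{r−1}((4−d)/2)log L`.
[cite: BalabanImbrieJaffe1988, (5.4.7) p.282] -/
theorem sum_scales_rLen_le {L ε e r c : ℝ} (hL : 1 ≤ L) (hε : 0 < ε) (he : 0 < e) (hr : 1 ≤ r) (hc : 0 ≤ c) {d : ℕ}
    (hd : d ≤ 4) {k : ℕ} (hek : eK L ε e d k < 1) (hek0 : 0 < eK L ε e d k)
    (hsmall : L ^ 2 * Real.exp (-(c * (r * Real.log (eK L ε e d k)⁻¹ ^ (r - 1) * (((4 - (d : ℝ)) / 2) * Real.log L))))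
      ≤ 1 / 2) :
    ∑ j ∈ Ico 1 k, L ^ (2 * (k - j)) * Real.exp (-(c * rLen r (eK L ε e d j)))
      ≤ Real.exp (-(c * rLen r (eK L ε e d k))) := by
  have h := smallness_sum_le (a := fun j => rLen r (eK L ε e d j)) (Λ := L ^ 2) k (by positivity) hc
    (fun j hj => rLen_scale_gap hL hε he hr hd hek hek0 (k - j) j (by omega)) hsmall
  refine le_trans (le_of_eq (Finset.sum_congr rfl fun j _ => ?_)) h
  rw [pow_mul]

/-! ## §3  The printed first inequality: «(2.7) and scaling properties», one tail at a time -/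

variable {α β γ : Type*}

/-- Telescoping at kernel level: `HCH* − H′C′H′* = (H−H′)CH* + H′(C−C′)H* + H′C′(H*−H′*)`.
[cite: BalabanImbrieJaffe1988, (5.4.3) p.282] -/
theorem comp₃_sub_comp₃ [Fintype β] [Fintype γ] {δ' : Type*} (H H' : α → β → ℝ) (C C' : β → γ → ℝ) (Hs Hs' : γ → δ' → ℝ)
    (a : α) (e : δ') :
    (∑ c, (∑ b, H a b * C b c) * Hs c e) - ∑ c, (∑ b, H' a b * C' b c) * Hs' c e
      = (∑ c, (∑ b, (H a b - H' a b) * C b c) * Hs c e) + (∑ c, (∑ b, H' a b * (C b c - C' b c)) * Hs c e)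
        + ∑ c, (∑ b, H' a b * C' b c) * (Hs c e - Hs' c e) := by
  rw [← Finset.sum_sub_distrib, ← Finset.sum_add_distrib, ← Finset.sum_add_distrib]
  refine Finset.sum_congr rfl fun c _ => ?_
  have h : ∑ b, (H a b - H' a b) * C b c + ∑ b, H' a b * (C b c - C' b c)
      = ∑ b, H a b * C b c - ∑ b, H' a b * C' b c := by
    rw [← Finset.sum_add_distrib, ← Finset.sum_sub_distrib]
    exact Finset.sum_congr rfl fun b _ => by ring
  rw [← add_mul, h]
  ring

/-- **One tail `G^{(j)} − G^{(j)}_{loc}` is small AND decays**: if `H, C, H*` and their localized versions decay (`≤ Ae^{−δρ}`, each factor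
on its carrier pair) and each localized kernel is ε-close to the exact one ((2.7): `|K_loc − K| ≤ εe^{−δρ}`), then
`|HCH*(a,e) − H_{loc}C_{loc}H*_{loc}(a,e)| ≤ 3εA²S₁S₂·e^{−(δ/4)ρ(a,e)}` (row sums S₁, S₂ and triangle inequalities as in
`BIJ88MultiscaleDecay223.abs_sum_mul_le_comp₃`). [cite: BalabanImbrieJaffe1988, (5.4.3) p.282] -/
theorem abs_comp₃_sub_comp₃_le [Fintype β] [Fintype γ] {δ' : Type*} {H H' : α → β → ℝ} {C C' : β → γ → ℝ}
    {Hs Hs' : γ → δ' → ℝ} {ρ₁ : α → β → ℝ} {ρ₂ : β → γ → ℝ} {ρ₃ : γ → δ' → ℝ} {ρ₁₂ : α → γ → ℝ} {ρ : α → δ' → ℝ}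
    {A ε δ S₁ S₂ : ℝ} (hA : 0 ≤ A) (hε : 0 ≤ ε) (hδ : 0 ≤ δ) (hρ₂ : ∀ b c, 0 ≤ ρ₂ b c) (hρ₃ : ∀ c e, 0 ≤ ρ₃ c e)
    (htri₁₂ : ∀ a b c, ρ₁₂ a c ≤ ρ₁ a b + ρ₂ b c) (htri : ∀ a c e, ρ a e ≤ ρ₁₂ a c + ρ₃ c e)
    (hC : ∀ b c, |C b c| ≤ A * Real.exp (-δ * ρ₂ b c)) (hHs : ∀ c e, |Hs c e| ≤ A * Real.exp (-δ * ρ₃ c e))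
    (hH' : ∀ a b, |H' a b| ≤ A * Real.exp (-δ * ρ₁ a b)) (hC' : ∀ b c, |C' b c| ≤ A * Real.exp (-δ * ρ₂ b c))
    (hdH : ∀ a b, |H a b - H' a b| ≤ ε * Real.exp (-δ * ρ₁ a b))
    (hdC : ∀ b c, |C b c - C' b c| ≤ ε * Real.exp (-δ * ρ₂ b c))
    (hdHs : ∀ c e, |Hs c e - Hs' c e| ≤ ε * Real.exp (-δ * ρ₃ c e))
    (hS₁ : ∀ a, ∑ b, Real.exp (-(δ / 2) * ρ₁ a b) ≤ S₁) (hS₂ : ∀ a, ∑ c, Real.exp (-(δ / 4) * ρ₁₂ a c) ≤ S₂)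
    (a : α) (e : δ') :
    |(∑ c, (∑ b, H a b * C b c) * Hs c e) - ∑ c, (∑ b, H' a b * C' b c) * Hs' c e|
      ≤ 3 * (ε * A * A * S₁ * S₂) * Real.exp (-(δ / 4) * ρ a e) := by
  rw [comp₃_sub_comp₃]
  have h1 := abs_sum_mul_le_comp₃ (H := fun a b => H a b - H' a b) (C := C) (Hs := Hs) hε hA hA hδ hρ₂ hρ₃ htri₁₂ htri
    hdH hC hHs hS₁ hS₂ a e
  have h2 := abs_sum_mul_le_comp₃ (H := H') (C := fun b c => C b c - C' b c) (Hs := Hs) hA hε hA hδ hρ₂ hρ₃ htri₁₂ htri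
    hH' hdC hHs hS₁ hS₂ a e
  have h3 := abs_sum_mul_le_comp₃ (H := H') (C := C') (Hs := fun c e => Hs c e - Hs' c e) hA hA hε hδ hρ₂ hρ₃ htri₁₂ htri
    hH' hC' hdHs hS₁ hS₂ a e
  calc _ ≤ |(∑ c, (∑ b, (H a b - H' a b) * C b c) * Hs c e) + ∑ c, (∑ b, H' a b * (C b c - C' b c)) * Hs c e|
        + |∑ c, (∑ b, H' a b * C' b c) * (Hs c e - Hs' c e)| := abs_add_le _ _
    _ ≤ (|∑ c, (∑ b, (H a b - H' a b) * C b c) * Hs c e| + |∑ c, (∑ b, H' a b * (C b c - C' b c)) * Hs c e|)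
        + |∑ c, (∑ b, H' a b * C' b c) * (Hs c e - Hs' c e)| := by gcongr; exact abs_add_le _ _
    _ ≤ (ε * A * S₁ * A * S₂ * Real.exp (-(δ / 4) * ρ a e) + A * ε * S₁ * A * S₂ * Real.exp (-(δ / 4) * ρ a e))
        + A * A * S₁ * ε * S₂ * Real.exp (-(δ / 4) * ρ a e) := add_le_add (add_le_add h1 h2) h3
    _ = 3 * (ε * A * A * S₁ * S₂) * Real.exp (-(δ / 4) * ρ a e) := by ring

/-! ## §4  The row shape `Ineq547` for the tail sums, the local right factor, `w′₁` and `w₁` -/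

/-- **Per-scale tails ⟹ the p. 282 bound (prefactor explicit)**: kernels `E_j` (the tails `(G^{(j)} − G^{(j)}_{loc})·(local factors)`
rescaled to step k) with `|E_j(x,b)| ≤ B·Λ^{k−j}·e^{−ca_j}·e^{−δ dist(x,b)}`, `a_j = r(e_j)` growing as in §1 and `Λe^{−cθ} ≤ ½`, sum to
`|Σ_{1≤j<k}E_j(x,b)| ≤ B·e^{−ca_k}·e^{−δ dist(x,b)}`. [cite: BalabanImbrieJaffe1988, (5.4.7) p.282] -/
theorem abs_tailSum_le {Site Bond : Type*} {dist : Site → Bond → ℝ} {E : ℕ → Site → Bond → ℝ} {a : ℕ → ℝ}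
    {Λ c θ δ B : ℝ} (k : ℕ) (hΛ : 0 ≤ Λ) (hc : 0 ≤ c) (hB : 0 ≤ B)
    (ha : ∀ j, j ≤ k → a k + ((k - j : ℕ) : ℝ) * θ ≤ a j) (hq : Λ * Real.exp (-(c * θ)) ≤ 1 / 2)
    (hE : ∀ j ∈ Ico 1 k, ∀ x b, |E j x b| ≤ B * Λ ^ (k - j) * Real.exp (-(c * a j)) * Real.exp (-(δ * dist x b)))
    (x : Site) (b : Bond) :
    |∑ j ∈ Ico 1 k, E j x b| ≤ B * Real.exp (-(c * a k)) * Real.exp (-(δ * dist x b)) := by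
  have hsum := smallness_sum_le k hΛ hc ha hq
  calc |∑ j ∈ Ico 1 k, E j x b| ≤ ∑ j ∈ Ico 1 k, |E j x b| := Finset.abs_sum_le_sum_abs _ _
    _ ≤ ∑ j ∈ Ico 1 k, B * (Λ ^ (k - j) * Real.exp (-(c * a j))) * Real.exp (-(δ * dist x b)) :=
        Finset.sum_le_sum fun j hj => by have := hE j hj x b; rw [← mul_assoc]; exact this
    _ = B * (∑ j ∈ Ico 1 k, Λ ^ (k - j) * Real.exp (-(c * a j))) * Real.exp (-(δ * dist x b)) := by
        rw [Finset.mul_sum, Finset.sum_mul]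
    _ ≤ B * Real.exp (-(c * a k)) * Real.exp (-(δ * dist x b)) :=
        mul_le_mul_of_nonneg_right (mul_le_mul_of_nonneg_left hsum hB) (Real.exp_pos _).le

/-- **THE TYPED ROW** `BIJ88Sect5StatementsPart2.Ineq547 Site Bond w dist c′ r(e_k)` for a tail sum `w = Σ_{1≤j<k}E_j`, once the explicit
prefactor is absorbed («e_k small»: `Be^{−cr(e_k)} ≤ e^{−c′r(e_k)}`) and `c′ ≤ δ` (nonnegative distance).
[cite: BalabanImbrieJaffe1988, (5.4.7) p.282] -/
theorem ineq547_tailSum {Site Bond : Type} {dist : Site → Bond → ℝ} {E : ℕ → Site → Bond → ℝ} {a : ℕ → ℝ}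
    {Λ c θ δ B c' : ℝ} (k : ℕ) (hΛ : 0 ≤ Λ) (hc : 0 ≤ c) (hB : 0 ≤ B) (hd : ∀ x b, 0 ≤ dist x b)
    (ha : ∀ j, j ≤ k → a k + ((k - j : ℕ) : ℝ) * θ ≤ a j) (hq : Λ * Real.exp (-(c * θ)) ≤ 1 / 2)
    (hE : ∀ j ∈ Ico 1 k, ∀ x b, |E j x b| ≤ B * Λ ^ (k - j) * Real.exp (-(c * a j)) * Real.exp (-(δ * dist x b)))
    (habs : B * Real.exp (-(c * a k)) ≤ Real.exp (-(c' * a k))) (hc'δ : c' ≤ δ) :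
    Ineq547 Site Bond (fun x b => ∑ j ∈ Ico 1 k, E j x b) dist c' (a k) := by
  intro x b
  refine (abs_tailSum_le k hΛ hc hB ha hq hE x b).trans ?_
  exact mul_le_mul habs (Real.exp_le_exp.2 (by have := hd x b; nlinarith)) (Real.exp_pos _).le (Real.exp_pos _).le

/-- **A local right factor keeps the shape** (the `∂*Q^{e*}_k∂□` of `w′₁ = (𝒟_k − 𝒟_{k,loc})∂*Q^{e*}_k∂□`, and `∂`, `∂*` for `∂w′₁`, `∂*w′₁`):
if `|E(x,y)| ≤ F·e^{−δ dist₂(x,y)}`, the columns of `X` have ℓ¹-norm `≤ q` and `X(y,b) ≠ 0 ⟹ dist(x,b) ≤ dist₂(x,y) + ρ`, then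
`|Σ_y E(x,y)X(y,b)| ≤ F·q·e^{δρ}·e^{−δ dist(x,b)}`. [cite: BalabanImbrieJaffe1988, (5.4.3) p.282] -/
theorem abs_mul_localRight_le [Fintype β] {E : α → β → ℝ} {X : β → γ → ℝ} {dist₂ : α → β → ℝ} {dist : α → γ → ℝ}
    {F δ q ρ : ℝ} (hF : 0 ≤ F) (hδ : 0 ≤ δ) (hE : ∀ x y, |E x y| ≤ F * Real.exp (-(δ * dist₂ x y)))
    (hXcol : ∀ b, ∑ y, |X y b| ≤ q) (hXglue : ∀ x y b, X y b ≠ 0 → dist x b ≤ dist₂ x y + ρ) (x : α) (b : γ) :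
    |∑ y, E x y * X y b| ≤ F * q * Real.exp (δ * ρ) * Real.exp (-(δ * dist x b)) := by
  have hterm : ∀ y, |E x y * X y b| ≤ F * Real.exp (δ * ρ) * Real.exp (-(δ * dist x b)) * |X y b| := by
    intro y
    by_cases hy : X y b = 0
    · simp [hy]
    · rw [abs_mul]
      refine mul_le_mul_of_nonneg_right ((hE x y).trans ?_) (abs_nonneg _)
      rw [mul_assoc, ← Real.exp_add]
      refine mul_le_mul_of_nonneg_left (Real.exp_le_exp.2 ?_) hF
      have := mul_le_mul_of_nonneg_left (hXglue x y b hy) hδ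
      nlinarith
  calc |∑ y, E x y * X y b| ≤ ∑ y, |E x y * X y b| := Finset.abs_sum_le_sum_abs _ _
    _ ≤ ∑ y, F * Real.exp (δ * ρ) * Real.exp (-(δ * dist x b)) * |X y b| := Finset.sum_le_sum fun y _ => hterm y
    _ = F * Real.exp (δ * ρ) * Real.exp (-(δ * dist x b)) * ∑ y, |X y b| := by rw [Finset.mul_sum]
    _ ≤ F * Real.exp (δ * ρ) * Real.exp (-(δ * dist x b)) * q := mul_le_mul_of_nonneg_left (hXcol b) (by positivity)
    _ = F * q * Real.exp (δ * ρ) * Real.exp (-(δ * dist x b)) := by ring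

section MatrixInstance

open Matrix

variable {ι : Type} [Fintype ι] [DecidableEq ι]

/-- r16's ring-level `w′₁ = (𝒟_k − 𝒟_{k,loc})∂*Q^{e*}_k∂□` in the kernel ring `Matrix ι ι ℝ` is the composite of the tail kernel `𝒟_k − 𝒟_{k,loc}`
with the local factor `X = ∂*Q^{e*}_k∂□`. [cite: BalabanImbrieJaffe1988, (5.4.3) p.282] -/
theorem wPrime1_apply (Dk Dloc ds Qes d box : Matrix ι ι ℝ) (x b : ι) :
    wPrime1 Dk Dloc ds Qes d box x b = ∑ y, (Dk - Dloc) x y * (ds * Qes * d * box) y b := by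
  simp only [wPrime1, Matrix.mul_assoc]
  rw [Matrix.mul_apply]

/-- **`w′₁` MODEL INSTANCE**: in `Matrix ι ι ℝ`, with the tail kernel bounded as in `abs_tailSum_le`
(`|(𝒟_k − 𝒟_{k,loc})(x,y)| ≤ B·e^{−cr_k}·e^{−δ dist₂(x,y)}`) and the local factor `X = ∂*Q^{e*}_k∂□` (column-ℓ¹ `≤ q`, range glue ρ), r16's
`wPrime1` satisfies the typed `Ineq547 ι ι w′₁ dist c′ r_k` once `Bqe^{δρ}e^{−cr_k} ≤ e^{−c′r_k}` and `c′ ≤ δ`.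
[cite: BalabanImbrieJaffe1988, (5.4.7) p.282] -/
theorem ineq547_wPrime1 (Dk Dloc ds Qes d box : Matrix ι ι ℝ) {dist₂ dist : ι → ι → ℝ} {B c δ q ρ rk c' : ℝ}
    (hB : 0 ≤ B) (hδ : 0 ≤ δ) (hd : ∀ x b, 0 ≤ dist x b)
    (htail : ∀ x y, |(Dk - Dloc) x y| ≤ B * Real.exp (-(c * rk)) * Real.exp (-(δ * dist₂ x y)))
    (hXcol : ∀ b, ∑ y, |(ds * Qes * d * box) y b| ≤ q)
    (hXglue : ∀ x y b, (ds * Qes * d * box) y b ≠ 0 → dist x b ≤ dist₂ x y + ρ)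
    (habs : B * Real.exp (-(c * rk)) * q * Real.exp (δ * ρ) ≤ Real.exp (-(c' * rk))) (hc'δ : c' ≤ δ) :
    Ineq547 ι ι (fun x b => wPrime1 Dk Dloc ds Qes d box x b) dist c' rk := by
  intro x b
  dsimp only
  rw [wPrime1_apply]
  have hF : 0 ≤ B * Real.exp (-(c * rk)) := mul_nonneg hB (Real.exp_pos _).le
  refine (abs_mul_localRight_le hF hδ htail hXcol hXglue x b).trans ?_
  exact mul_le_mul habs (Real.exp_le_exp.2 (by have := hd x b; nlinarith)) (Real.exp_pos _).le (Real.exp_pos _).le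

/-- `w₁ = w′₁ + H_k□ − H_{k,loc}` read column-wise on `□` (*"we use w′₁(b,b′) only for b in □₀ ⊂ □"*): with `□ = diagonal χ` and
`χ b = 1`, `w₁(x,b) = w′₁(x,b) + (H_k(x,b) − H_{k,loc}(x,b))`. [cite: BalabanImbrieJaffe1988, (5.4.4) p.282] -/
theorem w1_apply_col (Dk Dloc ds Qes d Hk Hloc : Matrix ι ι ℝ) (χ : ι → ℝ) {x b : ι} (hb : χ b = 1) :
    w1 Dk Dloc ds Qes d (diagonal χ) Hk Hloc x b
      = wPrime1 Dk Dloc ds Qes d (diagonal χ) x b + (Hk x b - Hloc x b) := by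
  simp only [w1, Matrix.add_apply, Matrix.sub_apply, Matrix.mul_diagonal, hb, mul_one]
  ring

/-- **`w₁` "satisfies the same bounds as w′₁"**: column-wise on `□`, from the `w′₁` bound (`Ineq547 … c′ r_k`) and (2.7)
`|H_{k,loc} − H_k| ≤ e^{−c₇r_k}e^{−c₇dist}` (r18's `Close`), `w₁` obeys `Ineq547 … c″ r_k` for any `c″ ≤ min(c′,c₇)` absorbing the
factor 2: `2e^{−min(c′,c₇)r_k} ≤ e^{−c″r_k}`, `c″ ≤ min(c′,c₇)`, `r_k ≥ 0`. [cite: BalabanImbrieJaffe1988, (5.4.4) p.282] -/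
theorem ineq547_w1 (Dk Dloc ds Qes d Hk Hloc : Matrix ι ι ℝ) (χ : ι → ℝ) {dist : ι → ι → ℝ} {c' c₇ c'' rk : ℝ}
    (hd : ∀ x b, 0 ≤ dist x b) (hrk : 0 ≤ rk)
    (hw' : Ineq547 ι ι (fun x b => wPrime1 Dk Dloc ds Qes d (diagonal χ) x b) dist c' rk)
    (h27 : Close dist Hloc Hk (Real.exp (-(c₇ * rk))) c₇)
    (habs : 2 * Real.exp (-(min c' c₇ * rk)) ≤ Real.exp (-(c'' * rk))) (hle : c'' ≤ min c' c₇) :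
    ∀ x b, χ b = 1 → |w1 Dk Dloc ds Qes d (diagonal χ) Hk Hloc x b|
      ≤ Real.exp (-(c'' * rk)) * Real.exp (-(c'' * dist x b)) := by
  intro x b hχ
  rw [w1_apply_col Dk Dloc ds Qes d Hk Hloc χ hχ]
  have hdx := hd x b
  have hm := Real.exp_le_exp.2 (neg_le_neg (mul_le_mul_of_nonneg_right hle hdx))
  -- the w′₁ part
  have h1 : |wPrime1 Dk Dloc ds Qes d (diagonal χ) x b|
      ≤ Real.exp (-(min c' c₇ * rk)) * Real.exp (-(min c' c₇ * dist x b)) := by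
    refine (hw' x b).trans (mul_le_mul ?_ ?_ (Real.exp_pos _).le (Real.exp_pos _).le)
    · exact Real.exp_le_exp.2 (neg_le_neg (mul_le_mul_of_nonneg_right (min_le_left _ _) hrk))
    · exact Real.exp_le_exp.2 (neg_le_neg (mul_le_mul_of_nonneg_right (min_le_left _ _) hdx))
  -- the (2.7) part
  have h2 : |Hk x b - Hloc x b| ≤ Real.exp (-(min c' c₇ * rk)) * Real.exp (-(min c' c₇ * dist x b)) := by
    rw [abs_sub_comm]
    refine (h27 x b).trans (mul_le_mul ?_ ?_ (Real.exp_pos _).le (Real.exp_pos _).le)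
    · exact Real.exp_le_exp.2 (neg_le_neg (mul_le_mul_of_nonneg_right (min_le_right _ _) hrk))
    · rw [neg_mul]
      exact Real.exp_le_exp.2 (neg_le_neg (mul_le_mul_of_nonneg_right (min_le_right _ _) hdx))
  calc |wPrime1 Dk Dloc ds Qes d (diagonal χ) x b + (Hk x b - Hloc x b)|
      ≤ |wPrime1 Dk Dloc ds Qes d (diagonal χ) x b| + |Hk x b - Hloc x b| := abs_add_le _ _
    _ ≤ 2 * Real.exp (-(min c' c₇ * rk)) * Real.exp (-(min c' c₇ * dist x b)) := by linarith
    _ ≤ Real.exp (-(c'' * rk)) * Real.exp (-(c'' * dist x b)) :=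
        mul_le_mul habs hm (Real.exp_pos _).le (Real.exp_pos _).le

end MatrixInstance

end

end Literature.MathematicalPhysics.QuantumFieldTheory.BalabanImbrieJaffe1984to88.BIJ88Ineq547W1Prime
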